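import Mathlib
import Summits.PneNP.PneNP.Theorems.ConvexRankGatesConvexGateBlindMonoMoment

/-!
# PneNP / ConvexRankGates — `ConvexGateBlind`: a non-negative weighting is rarely two-thirds monochromatic

Helpers (`--supports stmt-PneNP-10680`), COLUMN-SPACE line (prover seat 2, session 16): the second probabilistic input
of the second-generation catch bound (`…CatchTwo.lean`).

THEOREM (`card_monoMass_ge_twoThirds_le`, stub `nonneg_twoThirds_mono`). Let `V' ≥ 0` be a symmetric zero-diagonal
matrix on `Fin m` with total `½∑∑ V' = P > 0` and entries `≤ E`, and let `3 ≤ q`. Then the number of colourings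
`c : Fin m → Fin q` whose monochromatic mass `½∑∑ 𝟙[c a = c b] V' a b` is at least `(2/3)·P` is at most

  `q^m · exp(−P / (1152 · √(12·P·E)))  =  q^m · exp(−√(P/E) / 3991)`.

PROOF. Hubs `H' = {deg' ≥ τ'}`, `τ' = √(12PE)`: `#H' ≤ 2P/τ'`, so the (non-negative!) mass inside `H'` is
`≤ ½(2P/τ')²·E = P/6`; hence two-thirds monochromatic forces the hub-corrected centred mass
`M − M_{H'} − mass_out/q ≥ 2P/3 − P/6 − P/3 = P/6`, and `…MonoMoment.expMoment_le` with `λ = 1/(96τ')` plus Markov give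
`exp(−λP/6 + 4λ²·2Pτ') = exp(−P/(1152τ'))`. For a NON-NEGATIVE weighting no clique-non-negativity is needed: the expected
monochromatic fraction is `1/q` and only the entry bound limits the deviation. [new]
-/

set_option linter.dupNamespace false

namespace Summit.PneNP.PneNP.Theorems

open Finset Real

noncomputable section

variable {m : ℕ}

/-- **A non-negative weighting is rarely two-thirds monochromatic.** For `V' ≥ 0` symmetric with zero diagonal,
`½∑∑ V' = P > 0`, entries `≤ E`, and `3 ≤ q`:
`#{c : (2/3)P ≤ ½∑∑ 𝟙[c a = c b] V' a b} ≤ q^m · exp(−P/(1152·√(12PE)))`. [new] -/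
theorem card_monoMass_ge_twoThirds_le {q : ℕ} (hq : 3 ≤ q) (V' : Fin m → Fin m → ℝ) (hVsym : ∀ x y, V' x y = V' y x)
    (hV0 : ∀ x, V' x x = 0) (hnn : ∀ x y, 0 ≤ V' x y) {P E : ℝ} (hP : 0 < P) (hE : 0 < E)
    (hmass : ∑ x, ∑ y, V' x y = 2 * P) (hent : ∀ x y, V' x y ≤ E) :
    ((((Finset.univ : Finset (Fin m → Fin q)).filter fun c =>
        2 / 3 * P ≤ (∑ a, ∑ b, if c a = c b then V' a b else 0) / 2).card : ℝ)) ≤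
      (q : ℝ) ^ m * Real.exp (-(P / (1152 * Real.sqrt (12 * P * E)))) := by
  classical
  have hqpos : 0 < q := by omega
  have hqR3 : (3 : ℝ) ≤ q := by exact_mod_cast hq
  have hqRpos : (0 : ℝ) < q := by linarith
  -- degrees are sums of the (non-negative) entries
  have habs : ∀ x y, |V' x y| = V' x y := fun x y => abs_of_nonneg (hnn x y)
  have hdeg0 : ∀ x, 0 ≤ ∑ y, V' x y := fun x => Finset.sum_nonneg fun y _ => hnn x y
  -- the scale `τ'` and the hubs
  obtain ⟨τ, hτ⟩ : ∃ τ : ℝ, τ = Real.sqrt (12 * P * E) := ⟨_, rfl⟩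
  have hτpos : 0 < τ := by rw [hτ]; exact Real.sqrt_pos.2 (by positivity)
  have hτsq : τ ^ 2 = 12 * P * E := by rw [hτ, Real.sq_sqrt (by positivity)]
  obtain ⟨H, hH⟩ : ∃ H : Finset (Fin m), H = (Finset.univ : Finset (Fin m)).filter (fun x => τ ≤ ∑ y, V' x y) :=
    ⟨_, rfl⟩
  have hmemH : ∀ x, x ∈ H ↔ τ ≤ ∑ y, V' x y := fun x => by rw [hH, Finset.mem_filter]; simp
  have hHle : (H.card : ℝ) ≤ 2 * P / τ := by
    rw [le_div_iff₀ hτpos]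
    calc (H.card : ℝ) * τ = ∑ _x ∈ H, τ := by rw [Finset.sum_const, nsmul_eq_mul]
      _ ≤ ∑ x ∈ H, ∑ y, V' x y := Finset.sum_le_sum fun x hx => (hmemH x).1 hx
      _ ≤ ∑ x, ∑ y, V' x y := Finset.sum_le_sum_of_subset_of_nonneg (Finset.subset_univ _) fun x _ _ => hdeg0 x
      _ = 2 * P := hmass
  -- mass inside the hubs `≤ P/6`
  have hmassH : (∑ a ∈ H, ∑ b ∈ H, V' a b) / 2 ≤ P / 6 := by
    have h1 : ∑ a ∈ H, ∑ b ∈ H, V' a b ≤ (H.card : ℝ) * ((H.card : ℝ) * E) := by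
      calc ∑ a ∈ H, ∑ b ∈ H, V' a b ≤ ∑ _a ∈ H, ∑ _b ∈ H, E :=
            Finset.sum_le_sum fun a _ => Finset.sum_le_sum fun b _ => hent a b
        _ = (H.card : ℝ) * ((H.card : ℝ) * E) := by
            rw [Finset.sum_const, Finset.sum_const, nsmul_eq_mul, nsmul_eq_mul]
    have h2 : (H.card : ℝ) * ((H.card : ℝ) * E) ≤ (2 * P / τ) * ((2 * P / τ) * E) :=
      mul_le_mul hHle (mul_le_mul_of_nonneg_right hHle hE.le) (by positivity) (by positivity)
    have h3 : (2 * P / τ) * ((2 * P / τ) * E) = P / 3 := by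
      have : (2 * P / τ) * ((2 * P / τ) * E) = 4 * P ^ 2 * E / τ ^ 2 := by field_simp; ring
      rw [this, hτsq]
      field_simp
      ring
    linarith
  have hMH : ∀ c : Fin m → Fin q, (∑ a ∈ H, ∑ b ∈ H, if c a = c b then V' a b else 0) / 2 ≤ P / 6 := by
    intro c
    refine le_trans (div_le_div_of_nonneg_right (Finset.sum_le_sum fun a _ => Finset.sum_le_sum fun b _ => ?_)
      (by norm_num)) hmassH
    split_ifs
    · exact le_rfl
    · exact hnn a b
  have hmassHnn : 0 ≤ (∑ a ∈ H, ∑ b ∈ H, V' a b) / 2 :=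
    div_nonneg (Finset.sum_nonneg fun a _ => Finset.sum_nonneg fun b _ => hnn a b) (by norm_num)
  -- the centred hub-corrected mass `T`
  obtain ⟨T, hT⟩ : ∃ T : (Fin m → Fin q) → ℝ, ∀ c, T c =
      (∑ a, ∑ b, if c a = c b then V' a b else 0) / 2 - (∑ a ∈ H, ∑ b ∈ H, if c a = c b then V' a b else 0) / 2 -
        ((∑ a, ∑ b, V' a b) / 2 - (∑ a ∈ H, ∑ b ∈ H, V' a b) / 2) / q := ⟨fun c => _, fun c => rfl⟩
  have hsub : ((Finset.univ : Finset (Fin m → Fin q)).filter fun c =>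
        2 / 3 * P ≤ (∑ a, ∑ b, if c a = c b then V' a b else 0) / 2) ⊆
      (Finset.univ : Finset (Fin m → Fin q)).filter (fun c => P / 6 ≤ T c) := by
    intro c hc
    rw [Finset.mem_filter] at hc ⊢
    refine ⟨hc.1, ?_⟩
    have h1 := hc.2
    have h2 := hMH c
    have h3 : ((∑ a, ∑ b, V' a b) / 2 - (∑ a ∈ H, ∑ b ∈ H, V' a b) / 2) / q ≤ P / 3 := by
      rw [hmass]
      have hnum : 2 * P / 2 - (∑ a ∈ H, ∑ b ∈ H, V' a b) / 2 ≤ P := by linarith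
      have hP0 : 0 ≤ P := hP.le
      calc (2 * P / 2 - (∑ a ∈ H, ∑ b ∈ H, V' a b) / 2) / q ≤ P / q := div_le_div_of_nonneg_right hnum hqRpos.le
        _ ≤ P / 3 := div_le_div_of_nonneg_left hP0 (by norm_num) hqR3
    rw [hT c]
    linarith
  refine le_trans (Nat.cast_le.2 (Finset.card_le_card hsub)) ?_
  -- exponential moment + Markov
  obtain ⟨lam, hlam⟩ : ∃ lam : ℝ, lam = 1 / (96 * τ) := ⟨_, rfl⟩
  have hlam0 : 0 ≤ lam := by rw [hlam]; positivity
  have hdegH : ∀ x, x ∉ H → 2 * lam * ∑ y, |V' x y| ≤ 1 := by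
    intro x hx
    have hlt : ∑ y, V' x y < τ := by
      by_contra hge
      exact hx ((hmemH x).2 (not_lt.1 hge))
    have heq : ∑ y, |V' x y| = ∑ y, V' x y := Finset.sum_congr rfl fun y _ => habs x y
    rw [heq]
    calc 2 * lam * ∑ y, V' x y ≤ 2 * lam * τ := mul_le_mul_of_nonneg_left hlt.le (by positivity)
      _ = 1 / 48 := by rw [hlam]; field_simp; ring
      _ ≤ 1 := by norm_num
  have hmom := expMoment_le V' hVsym hV0 hqpos H hlam0 hdegH (q := q)
  simp only [← hT] at hmom
  have hmarkov := card_filter_le_mul_exp T hlam0 (P / 6)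
  have hdeg2 : ∑ x ∈ Hᶜ, (∑ y, |V' x y|) ^ 2 ≤ τ * (2 * P) := by
    have heq : ∀ x, ∑ y, |V' x y| = ∑ y, V' x y := fun x => Finset.sum_congr rfl fun y _ => habs x y
    simp_rw [heq]
    calc ∑ x ∈ Hᶜ, (∑ y, V' x y) ^ 2 ≤ ∑ x ∈ Hᶜ, τ * ∑ y, V' x y := by
          refine Finset.sum_le_sum fun x hx => ?_
          have hx' : x ∉ H := Finset.mem_compl.1 hx
          have hlt : ∑ y, V' x y < τ := by
            by_contra hge
            exact hx' ((hmemH x).2 (not_lt.1 hge))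
          rw [sq]
          exact mul_le_mul_of_nonneg_right hlt.le (hdeg0 x)
      _ = τ * ∑ x ∈ Hᶜ, ∑ y, V' x y := by rw [Finset.mul_sum]
      _ ≤ τ * ∑ x, ∑ y, V' x y := by
          refine mul_le_mul_of_nonneg_left ?_ hτpos.le
          exact Finset.sum_le_sum_of_subset_of_nonneg (Finset.subset_univ _) fun x _ _ => hdeg0 x
      _ = τ * (2 * P) := by rw [hmass]
  have h1 : Real.exp (4 * lam ^ 2 * ∑ x ∈ Hᶜ, (∑ y, |V' x y|) ^ 2) ≤ Real.exp (4 * lam ^ 2 * (τ * (2 * P))) :=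
    Real.exp_le_exp.2 (mul_le_mul_of_nonneg_left hdeg2 (by positivity))
  have h2 : -(lam * (P / 6)) + 4 * lam ^ 2 * (τ * (2 * P)) = -(P / (1152 * τ)) := by
    rw [hlam]
    field_simp
    ring
  calc ((((Finset.univ : Finset (Fin m → Fin q)).filter (fun c => P / 6 ≤ T c)).card : ℝ))
      ≤ Real.exp (-(lam * (P / 6))) * ∑ c, Real.exp (lam * T c) := hmarkov
    _ ≤ Real.exp (-(lam * (P / 6))) * ((q : ℝ) ^ m * Real.exp (4 * lam ^ 2 * ∑ x ∈ Hᶜ, (∑ y, |V' x y|) ^ 2)) :=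
        mul_le_mul_of_nonneg_left hmom (Real.exp_pos _).le
    _ ≤ Real.exp (-(lam * (P / 6))) * ((q : ℝ) ^ m * Real.exp (4 * lam ^ 2 * (τ * (2 * P)))) :=
        mul_le_mul_of_nonneg_left (mul_le_mul_of_nonneg_left h1 (by positivity)) (Real.exp_pos _).le
    _ = (q : ℝ) ^ m * Real.exp (-(lam * (P / 6)) + 4 * lam ^ 2 * (τ * (2 * P))) := by
        rw [Real.exp_add]; ring
    _ = (q : ℝ) ^ m * Real.exp (-(P / (1152 * τ))) := by rw [h2]
    _ = (q : ℝ) ^ m * Real.exp (-(P / (1152 * Real.sqrt (12 * P * E)))) := by rw [hτ]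

/-- **A non-negative weighting is rarely two-thirds monochromatic** (registered form of
`card_monoMass_ge_twoThirds_le`). [new] -/
theorem nonneg_twoThirds_mono : ∀ {m q : ℕ}, 3 ≤ q → ∀ (V' : Fin m → Fin m → ℝ), (∀ x y, V' x y = V' y x) → (∀ x, V' x x = 0) → (∀ x y, 0 ≤ V' x y) → ∀ (P E : ℝ), 0 < P → 0 < E → ∑ x, ∑ y, V' x y = 2 * P → (∀ x y, V' x y ≤ E) → ((((Finset.univ : Finset (Fin m → Fin q)).filter fun c => 2 / 3 * P ≤ (∑ a, ∑ b, if c a = c b then V' a b else 0) / 2).card : ℝ)) ≤ (q : ℝ) ^ m * Real.exp (-(P / (1152 * Real.sqrt (12 * P * E)))) :=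
  fun hq V' hVsym hV0 hnn _ _ hP hE hmass hent => card_monoMass_ge_twoThirds_le hq V' hVsym hV0 hnn hP hE hmass hent

end

end Summit.PneNP.PneNP.Theorems
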